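import Summits.QuantumFields.BalabanUV.Beta.GAN24.DirichletVertexEnergy
import Summits.QuantumFields.BalabanUV.Beta.GAN24.DirichletVertexLocate

/-!
# `BalabanUV.Beta.GAN24.DirichletVertexEnergyField` — binder row G-an2-4 / (CONV-C), road P2 PART IV, leaf L14 (the torus transfer), FILE B1′:
# BINDER (B) IN FIELD FORM and for ANY decidable spelling of the block region; the family of ALL re-entrant vertices; the dyadic depth
# (unit b2b-balaban-gan24-p2, gen 27, v1)

HONEST FRAMING (cell contract, verbatim): «discharging `BetaPertH` makes Bałaban's UV stability UNCONDITIONAL — a real constructive-QFT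
result; it is NOT the continuum limit and NOT the Clay problem.»  SUPPLIER module under the T⁴-DAG sub-row `T4-U1a.S-NE2-D1-DIRICHLET°`
(owner wording R24 «the full rate L⁻¹ beyond boxes OPEN»).  `DirichletVertexEnergy.weighted_energy_solExt_le` (p244737) is binder (B) for
`u = solExt_{blockReg n M S} f`.  The flux binders and the fine level of the weighted socket (p234489) need (B) for EVERY `u` vanishing off
`Ω` (field form) and for the Dirichlet solution of the refined region, which the socket spells `refineR N R M Ω` (pointwise equivalent to
`blockReg (R·N) M S`, `DirichletBoxTwoLevelCore.refineR_blockReg_iff`).  THIS FILE re-packages p244737's proof accordingly (no new estimate),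
names the family `Vre S` of ALL re-entrant vertices, and picks the dyadic depth `J(n)` with `20·2^J + 1 ≤ n − 1` and `⌊n/4⌋ + 6 ≤ 2^{J+4}`.

## Contents ([folklore]; 0 sorry)
* §1 **`weighted_energy_le_field`**, **`weighted_energy_solExt_le'`** (generic decidable `p ↔ blockReg n M S`).
* §2 `Vre`, `mem_Vre`; §3 `exists_J` (`n ≥ 64`).

ABSOLUTE RULE (cell, verbatim): «No internally-minted statement may enter as a cited fact. Every hypothesis is either kernel-proved in
this package or a verbatim quotation of a PUBLISHED theorem with page reference. The manuscript(s) under audit are NOT citable for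
their own disputed steps — they are the thing under adjudication; programme-internal (2001/route/tribunal) claims are never citable.»
Nothing printed is a hypothesis.  NOT CLAIMED: (A′), (Φ)/(Φ′), the END (p234489 stays CONDITIONAL); NOT NE2, (CONV-C), `BetaPertH`,
continuum, Clay.  «not in print; our proof attempt».  HONEST DEPENDENCY: continuum YM on T⁴ ⇐ BetaPertH ∧ nine spine estimates (0/9
proved); BetaPertH ⇐ (D1) ∧ (D4) ∧ CAP+tail; G-an2-4 gates asym, D1 and NE2/3/4.
-/

noncomputable section

open scoped BigOperators ComplexConjugate Matrix
open Finset

namespace Summit.QuantumFields.BalabanUV.Beta.GAN24.DirichletVertexEnergyField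

open Literature.MathematicalPhysics.QuantumFieldTheory.Balaban1983to89.B5Prop11Plancherel (Tor fine unitVec)
open Literature.MathematicalPhysics.QuantumFieldTheory.Balaban1983to89.B5Action121 (sdiff LapS)
open Literature.MathematicalPhysics.QuantumFieldTheory.Balaban1983to89.B5Prop11Lower (nsq nsq_nonneg)
open Summit.QuantumFields.BalabanUV.T4Continuum.ScalarAveragedPropagator (gammaPs gammaPs_pos dirichlet)
open Summit.QuantumFields.BalabanUV.Beta.GAN24.DirichletBoxTrace (blockReg)
open Summit.QuantumFields.BalabanUV.Beta.GAN24.DirichletBoxCompression (solExt solExt_apply_of_not dirichlet_solExt_le sum_normSq_LapS_solExt_le)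
open DirichletVertexChart
open DirichletVertexEnergy (invW omegaV inv_omegaV betaV vertex_weighted_energy_le)

variable (n : ℕ) [NeZero n] (M : Fin 2 → ℕ) [hM : ∀ μ, NeZero (M μ)] (S : Tor M → Prop) [DecidablePred S]

/-! ## §1 Binder (B) in field form and for a generic spelling of the region -/

/-- **BINDER (B), FIELD FORM**: for `u` vanishing off `Ω = blockReg n M S`, any finite family `V` of re-entrant vertices, `2 ≤ n`, `2 ≤ M_ν`,
`0 < ε`, `1 < γ = π/3·(1−ε/2)`:
`Σ_μ Σ_y ω_V(y)⁻¹|(∂_μu)(y)|² ≤ (1 + 4|V|(1+16/(γ−1)))·(‖∂₀u‖²+‖∂₁u‖²) + |V|·(128π/((γ−1)ε(2−γ)))·Σ_{x∈Ω}|Δu|²`. [folklore] -/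
theorem weighted_energy_le_field (V : Finset ((Fin 2 → Bool) × Tor M)) (hV : ∀ v ∈ V, ReentrantAt M S v.1 v.2)
    (hn : 2 ≤ n) (hM0 : 2 ≤ M 0) (hM1 : 2 ≤ M 1) {ε : ℝ} (hε : 0 < ε) (hγ : 1 < Real.pi / 3 * (1 - ε / 2))
    {u : Tor (fine n M) → ℂ} (hu : ∀ x, ¬ blockReg n M S x → u x = 0) :
    ∑ μ, ∑ y, (omegaV n M V (n - 1) y)⁻¹ * ‖(sdiff (fine n M) (n : ℂ) μ *ᵥ u) y‖ ^ 2
      ≤ (1 + V.card * (4 * (1 + 16 / (Real.pi / 3 * (1 - ε / 2) - 1))))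
          * (nsq (sdiff (fine n M) (n : ℂ) 0 *ᵥ u) + nsq (sdiff (fine n M) (n : ℂ) 1 *ᵥ u))
        + V.card * (128 * Real.pi / ((Real.pi / 3 * (1 - ε / 2) - 1) * ε * (2 - Real.pi / 3 * (1 - ε / 2))))
          * ∑ x ∈ univ.filter (blockReg n M S), ‖(LapS (fine n M) (n : ℂ) *ᵥ u) x‖ ^ 2 := by
  set E := nsq (sdiff (fine n M) (n : ℂ) 0 *ᵥ u) + nsq (sdiff (fine n M) (n : ℂ) 1 *ᵥ u) with hE
  set B := ∑ x ∈ univ.filter (blockReg n M S), ‖(LapS (fine n M) (n : ℂ) *ᵥ u) x‖ ^ 2 with hB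
  have hsplit : ∑ μ, ∑ y, (omegaV n M V (n - 1) y)⁻¹ * ‖(sdiff (fine n M) (n : ℂ) μ *ᵥ u) y‖ ^ 2
      = E + ∑ v ∈ V, ∑ μ, ∑ y, invW n M v (n - 1) y * ‖(sdiff (fine n M) (n : ℂ) μ *ᵥ u) y‖ ^ 2 := by
    calc ∑ μ, ∑ y, (omegaV n M V (n - 1) y)⁻¹ * ‖(sdiff (fine n M) (n : ℂ) μ *ᵥ u) y‖ ^ 2
        = ∑ μ, ∑ y, (‖(sdiff (fine n M) (n : ℂ) μ *ᵥ u) y‖ ^ 2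
            + ∑ v ∈ V, invW n M v (n - 1) y * ‖(sdiff (fine n M) (n : ℂ) μ *ᵥ u) y‖ ^ 2) := by
          refine sum_congr rfl fun μ _ => sum_congr rfl fun y _ => ?_
          rw [inv_omegaV, add_mul, one_mul, sum_mul]
      _ = (∑ μ, ∑ y, ‖(sdiff (fine n M) (n : ℂ) μ *ᵥ u) y‖ ^ 2)
            + ∑ μ, ∑ y, ∑ v ∈ V, invW n M v (n - 1) y * ‖(sdiff (fine n M) (n : ℂ) μ *ᵥ u) y‖ ^ 2 := by
          simp only [sum_add_distrib]
      _ = _ := by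
          congr 1
          · rw [hE, Fin.sum_univ_two, nsq, nsq]
          · calc ∑ μ, ∑ y, ∑ v ∈ V, invW n M v (n - 1) y * ‖(sdiff (fine n M) (n : ℂ) μ *ᵥ u) y‖ ^ 2
                = ∑ μ, ∑ v ∈ V, ∑ y, invW n M v (n - 1) y * ‖(sdiff (fine n M) (n : ℂ) μ *ᵥ u) y‖ ^ 2 :=
                  sum_congr rfl fun μ _ => sum_comm
              _ = _ := sum_comm
  rw [hsplit]
  have hv : ∀ v ∈ V, ∑ μ, ∑ y, invW n M v (n - 1) y * ‖(sdiff (fine n M) (n : ℂ) μ *ᵥ u) y‖ ^ 2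
      ≤ 4 * (1 + 16 / (Real.pi / 3 * (1 - ε / 2) - 1)) * E
        + 128 * Real.pi / ((Real.pi / 3 * (1 - ε / 2) - 1) * ε * (2 - Real.pi / 3 * (1 - ε / 2))) * B :=
    fun v hvV => vertex_weighted_energy_le n M (σ := v.1) (b := v.2) hu (hV v hvV) hn hM0 hM1 hε hγ
  calc E + ∑ v ∈ V, ∑ μ, ∑ y, invW n M v (n - 1) y * ‖(sdiff (fine n M) (n : ℂ) μ *ᵥ u) y‖ ^ 2
      ≤ E + ∑ v ∈ V, (4 * (1 + 16 / (Real.pi / 3 * (1 - ε / 2) - 1)) * E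
        + 128 * Real.pi / ((Real.pi / 3 * (1 - ε / 2) - 1) * ε * (2 - Real.pi / 3 * (1 - ε / 2))) * B) := by
          gcongr with v hvV; exact hv v hvV
    _ = _ := by rw [sum_const, nsmul_eq_mul]; ring

variable (a' : ℝ)

/-- **BINDER (B) FOR ANY DECIDABLE SPELLING OF THE BLOCK REGION**: for `p ↔ blockReg n M S` and `u = solExt n M a′ p f`,
`Σ_μ Σ_y ω_V(y)⁻¹|(∂_μu)(y)|² ≤ β_V·‖f‖²` (constant `betaV` of p244737). [folklore] -/
theorem weighted_energy_solExt_le' (V : Finset ((Fin 2 → Bool) × Tor M)) (hV : ∀ v ∈ V, ReentrantAt M S v.1 v.2)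
    (hn : 2 ≤ n) (hM0 : 2 ≤ M 0) (hM1 : 2 ≤ M 1) (ha' : 0 < a') {ε : ℝ} (hε : 0 < ε) (hγ : 1 < Real.pi / 3 * (1 - ε / 2))
    (p : Tor (fine n M) → Prop) [DecidablePred p] (hp : ∀ x, p x ↔ blockReg n M S x) (f : {y // p y} → ℂ) :
    ∑ μ, ∑ y, (omegaV n M V (n - 1) y)⁻¹ * ‖(sdiff (fine n M) (n : ℂ) μ *ᵥ solExt n M a' p f) y‖ ^ 2
      ≤ betaV V.card ε a' * nsq f := by
  set u := solExt n M a' p f with hu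
  have hu0 : ∀ x, ¬ blockReg n M S x → u x = 0 := fun x hx => solExt_apply_of_not n M a' p f (fun h => hx ((hp x).mp h))
  have hγp := (gammaPs_pos (d := 2) (a' := a')).1
  have hπ3 := Real.pi_gt_three
  have hε2 : ε < 2 := by
    by_contra h
    have : Real.pi / 3 * (1 - ε / 2) ≤ 0 := mul_nonpos_of_nonneg_of_nonpos (by positivity) (by linarith)
    linarith
  have hγ1 : 0 < Real.pi / 3 * (1 - ε / 2) - 1 := by linarith
  have h2γ : 0 < 2 - Real.pi / 3 * (1 - ε / 2) := by
    have h1 : Real.pi / 3 * (1 - ε / 2) ≤ Real.pi / 3 * 1 := mul_le_mul_of_nonneg_left (by linarith) (by positivity)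
    linarith [Real.pi_lt_four]
  have hE : nsq (sdiff (fine n M) (n : ℂ) 0 *ᵥ u) + nsq (sdiff (fine n M) (n : ℂ) 1 *ᵥ u) ≤ (gammaPs 2 a')⁻¹ * nsq f := by
    have h := dirichlet_solExt_le n M a' p ha' f
    rw [dirichlet, Fin.sum_univ_two] at h
    exact h
  have hB : ∑ x ∈ univ.filter (blockReg n M S), ‖(LapS (fine n M) (n : ℂ) *ᵥ u) x‖ ^ 2 ≤ 2 * (1 + (a' * (gammaPs 2 a')⁻¹) ^ 2) * nsq f := by
    rw [Finset.sum_subtype (univ.filter (blockReg n M S)) (p := p) (fun x => by simp [hp x])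
      (fun x => ‖(LapS (fine n M) (n : ℂ) *ᵥ u) x‖ ^ 2)]
    exact sum_normSq_LapS_solExt_le n M a' p ha' f
  have hf0 := nsq_nonneg f
  have hfield := weighted_energy_le_field n M S V hV hn hM0 hM1 hε hγ hu0
  refine hfield.trans ?_
  have hV0 : (0 : ℝ) ≤ V.card := Nat.cast_nonneg _
  have hc1 : 0 ≤ 1 + V.card * (4 * (1 + 16 / (Real.pi / 3 * (1 - ε / 2) - 1))) := by positivity
  have hc2 : 0 ≤ V.card * (128 * Real.pi / ((Real.pi / 3 * (1 - ε / 2) - 1) * ε * (2 - Real.pi / 3 * (1 - ε / 2)))) := by positivity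
  calc _ ≤ (1 + V.card * (4 * (1 + 16 / (Real.pi / 3 * (1 - ε / 2) - 1)))) * ((gammaPs 2 a')⁻¹ * nsq f)
        + V.card * (128 * Real.pi / ((Real.pi / 3 * (1 - ε / 2) - 1) * ε * (2 - Real.pi / 3 * (1 - ε / 2))))
          * (2 * (1 + (a' * (gammaPs 2 a')⁻¹) ^ 2) * nsq f) :=
        add_le_add (mul_le_mul_of_nonneg_left hE hc1) (mul_le_mul_of_nonneg_left hB hc2)
    _ = betaV V.card ε a' * nsq f := by rw [betaV]; ring

/-! ## §2 The family of all re-entrant vertices -/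

/-- **ALL RE-ENTRANT VERTICES** of the block set `S` (classically filtered). [folklore] -/
def Vre (S : Tor M → Prop) : Finset ((Fin 2 → Bool) × Tor M) := univ.filter (fun v => ReentrantAt M S v.1 v.2)

omit [DecidablePred S] in
/-- membership. [folklore] -/
theorem mem_Vre (v : (Fin 2 → Bool) × Tor M) : v ∈ Vre M S ↔ ReentrantAt M S v.1 v.2 := by
  unfold Vre; rw [mem_filter]; simp

omit [DecidablePred S] in
/-- soundness: every member is re-entrant. [folklore] -/
theorem Vre_sound : ∀ v ∈ Vre M S, ReentrantAt M S v.1 v.2 := fun v hv => (mem_Vre M S v).mp hv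

omit [DecidablePred S] in
/-- completeness: every re-entrant vertex is a member. [folklore] -/
theorem Vre_complete : ∀ σ b, ReentrantAt M S σ b → (σ, b) ∈ Vre M S := fun σ b h => (mem_Vre M S (σ, b)).mpr h

/-! ## §3 The dyadic depth -/

omit [NeZero n] hM [DecidablePred S] in
/-- **THE DYADIC DEPTH**: for `n ≥ 64` there is `J` with `20·2^J + 1 ≤ n − 1` and `⌊n/4⌋ + 6 ≤ 2·2^{J+3}`. [folklore] -/
theorem exists_J (hn : 64 ≤ n) : ∃ J : ℕ, 20 * 2 ^ J + 1 ≤ n - 1 ∧ n / 4 + 6 ≤ 2 * 2 ^ (J + 3) := by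
  set m : ℕ := (n - 2) / 20 with hm
  have hm0 : m ≠ 0 := by omega
  refine ⟨Nat.log 2 m, ?_, ?_⟩
  · have h := Nat.pow_log_le_self 2 hm0
    omega
  · have h := Nat.lt_pow_succ_log_self (b := 2) (by norm_num) m
    have e : 2 * 2 ^ (Nat.log 2 m + 3) = 8 * 2 ^ (Nat.log 2 m).succ := by rw [Nat.succ_eq_add_one]; ring
    rw [e]
    omega

end Summit.QuantumFields.BalabanUV.Beta.GAN24.DirichletVertexEnergyField

end
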